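import Summits.HodgeConjecture.HodgeConjecture.Theorems.F0D9opRoad2Pen
import HarnessLib

/-!
# `F0D9opRoad2PenCongruence` — ★ RE-HOME of `Lines/F0_D9opRoad2.lean`, PART 3 of 6 (size-lint split; cut at a declaration boundary).

Imports (bare lines; provenance here): `Theorems.F0D9opRoad2Pen` = ★ the previous part of the same `Lines` workfile (size-lint split ×6) · `HarnessLib`.
See PART 1 `Theorems/F0D9opRoad2Boundary.lean` for the full re-home header and the original module docstring (verbatim there). Namespaces and sections KEPT
(re-opened below exactly as they stand at the cut, with their `open`∕`variable` lines replayed); code bytes = the workfile՚s, docstrings included; options preamble repeated from PART 1.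
HC_CM is proved only modulo the 7 printed citations (2 remaining: hLiu418 = stmt-HodgeConjecture-24832, h413 = stmt-HodgeConjecture-24833) until rung 0 closes; a re-home is count-neutral. -/

namespace Summit.HodgeConjecture.HodgeConjecture.Cruxes.HLiu418.F0D9opRoad2
set_option linter.dupNamespace false  -- `Summit.HodgeConjecture.HodgeConjecture.…` BY DESIGN (D-0017), as in `Lines/d6_cm_curve.lean`
open CategoryTheory NumberField IsDedekindDomain MulAction
open scoped Matrix MonObj CategoryTheory.Obj
open MonoidalCategory
open Summit.HodgeConjecture.CorCM.Lines.A3Liu418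
open Literature.AlgebraicGeometry.Motives (AbelianVariety)
open Literature.AlgebraicGeometry.Motives.AbelianVariety (rationalTateModuleMap frobeniusHom zsmul_eq_zsmul_trace_comp_of_pin
  exists_finite_forall_exists_goodReductionAt_homReduction_tateSpecialisation)
open Literature.NumberTheory.GaloisRepresentations
open Literature.NumberTheory.Automorphic Literature.NumberTheory.Automorphic.UnitaryGroup
open Literature.AlgebraicGeometry.ShimuraVarieties.UnitaryCanonicalModel
open Literature.NumberTheory.Automorphic.Liu2021.AppendixC
open Literature.AlgebraicGeometry.Motives (AlgPoints IntegralModel frobeniusOver SchemeOver)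
open Literature.NumberTheory.DiophantineGeometry (geomResidueField)

section Edition5Desk
open Literature.NumberTheory.EllipticCurves (genericFibre)
open Literature.NumberTheory.DiophantineGeometry (specialFibreFunctor)
open IsLocalRing (closedPoint)

namespace PenLemmas
open AlgebraicGeometry CategoryTheory.Limits IsDedekindDomain.HeightOneSpectrum IsLocalRing
open Literature.NumberTheory.DiophantineGeometry (specResidueField)


/-! ### §2b The PEN core: C3 at level `K` from the MOD datum at the cofinal level `Kc`, Γ3-Q, DEG and the DESC data (general `t₁ t₂`) -/

set_option maxHeartbeats 400000 in
/-- **ED. 5 PEN core (road L-B′), general `t₁ t₂`.**  C3 at `(K, 𝒮, N, r₁, r₂, x)` from: a cofinal level `Kc ≤ K` with model `𝒮c` and a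
model morphism `ū : 𝒮c ⟶ 𝒮` over `u_{Kc→K}`; the two-section datum at `(Kc, 𝒮c)`; DESC data (`N′, x′, rc₁, rc₂, e₁, e₂` and the two
translate identities); Γ3-Q at `(Kc, K₁, N′, rc₁, x′)` (surjective lift); DEG (a)(b) at `Kc`; MOD (7) at `u x′`.  The lift is then
bijective by counting, the CORE (§2) gives C3 at `Kc`, §1d pushes it along `ū_v`, and the sums are reindexed along `e₁ e₂`.
[cite: Liu2021, Prop. D.8 (1)–(3) and proof of Cor. D.9 p. 139 L4–L31] [cite: SerreTate1968, §1] -/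
theorem congruenceOnPoints_at_of_descent
    (F : Type) [Field F] [NumberField F] [IsCMField F] [IsGalois ℚ F] (ι₁ : F →+* ℂ)
    (Jstar : Matrix (Fin 2) (Fin 2) F)
    (K₀ : C5.OpenCompactSubgroup ↥(finAdelic ↥(maximalRealSubfield F) F (IsCMField.complexConj F) 2 Jstar))
    (S : RecordSystemGS F Jstar ι₁ K₀) (hU7ₛ : S.HeckeTranslateDefinedOver) (K : C5.SmallLevel K₀)
    (w : HeightOneSpectrum (𝓞 F))
    (𝒮 : IntegralModel (HeightOneSpectrum.valuationSubringAtPrime F w) F (S.M.obj K))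
    [IsProper 𝒮.total.hom]
    (t₁ t₂ : ↥(finAdelic ↥(maximalRealSubfield F) F (IsCMField.complexConj F) 2 Jstar))
    -- the cofinal level `Kc ≤ K`, its smooth proper model `𝒮c` and the model morphism `ū : 𝒮c ⟶ 𝒮` over `u_{Kc→K}` (MOD)
    (Kc : C5.SmallLevel K₀) (hKcK : Kc ≤ K)
    (𝒮c : IntegralModel (HeightOneSpectrum.valuationSubringAtPrime F w) F (S.M.obj Kc)) [IsProper 𝒮c.total.hom]
    (ū : 𝒮c.total ⟶ 𝒮.total)
    (hū : (genericFibre (HeightOneSpectrum.valuationSubringAtPrime F w) F).map ū ≫ 𝒮.genericIso'.hom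
       = 𝒮c.genericIso'.hom ≫ S.M.map (homOfLE hKcK))
    -- the two-section datum of the MOD letter at `(Kc, 𝒮c)` for `K₁ = Kc ∩ t₁ Kc t₁⁻¹` (clauses (1) (2) (4) (5) (6))
    (K₁ : C5.SmallLevel K₀) (hle : K₁ ≤ Kc)
    (ht : C5.HeckeLE t₁ K₁ Kc)
    (ht₂ : C5.HeckeLE t₂ Kc Kc)
    (𝒯 : IntegralModel (HeightOneSpectrum.valuationSubringAtPrime F w) F (S.M.obj K₁))
    [IsProper 𝒯.total.hom]
    (π₁ π₂ : 𝒯.total ⟶ 𝒮c.total)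
    [Flat π₁.left] [LocallyOfFinitePresentation π₁.left] [IsFinite π₁.left]
    (hπ₁ : (genericFibre (HeightOneSpectrum.valuationSubringAtPrime F w) F).map π₁ ≫ 𝒮c.genericIso'.hom
       = 𝒯.genericIso'.hom ≫ S.M.map (homOfLE hle))
    (hπ₂ : (genericFibre (HeightOneSpectrum.valuationSubringAtPrime F w) F).map π₂ ≫ 𝒮c.genericIso'.hom
       = 𝒯.genericIso'.hom ≫ Literature.NumberTheory.Automorphic.Liu2021.AppendixC.recordHeckeTranslateGS S hU7ₛ _ K₁ Kc ht)
    (s s' : AlgPoints 𝒮c.reductionAt (geomResidueField w) → AlgPoints 𝒯.reductionAt (geomResidueField w))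
    (V : (𝒯.reductionAt).left.Opens)
    [IsOpenImmersion (V.ι ≫ ((specialFibreFunctor w).map π₁).left)]
    (hcov : ∀ (z : AlgPoints 𝒯.reductionAt (geomResidueField w)) (yb : AlgPoints 𝒮c.reductionAt (geomResidueField w)),
        AlgPoints.map ((specialFibreFunctor w).map π₁) z = yb → z = s yb ∨ z = s' yb)
    (hs : ∀ yb : AlgPoints 𝒮c.reductionAt (geomResidueField w), AlgPoints.map ((specialFibreFunctor w).map π₁) (s yb) = yb)
    (hV : ∀ yb : AlgPoints 𝒮c.reductionAt (geomResidueField w),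
        s yb ≠ s' yb → (s yb).toSpecHom.base (closedPoint (geomResidueField w)) ∈ V)
    (hs₂ : ∀ yb : AlgPoints 𝒮c.reductionAt (geomResidueField w),
        AlgPoints.map ((specialFibreFunctor w).map π₂) (s yb) = AlgPoints.map (frobeniusOver 𝒮c.reductionAt) yb)
    (hs'₂ : ∀ y : AlgPoints (S.M.obj Kc) (AlgebraicClosure (w.adicCompletion F)),
        AlgPoints.map (frobeniusOver 𝒮c.reductionAt)
            (AlgPoints.map ((specialFibreFunctor w).map π₂) (s' (𝒮c.geomReductionMap y)))
          = 𝒮c.geomReductionMap (AlgPoints.map (Literature.NumberTheory.Automorphic.Liu2021.AppendixC.recordHeckeTranslateGS S hU7ₛ _ Kc Kc ht₂) y))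
    -- the point `x ∈ M⋆_N(Ω)` at level `K`, its C3 index families, and the DESC data
    (N : C5.SmallLevel K₀) (hNK : N ≤ K)
    (r₁ : ↥(orbit (K.1.1 : Subgroup ↥(finAdelic ↥(maximalRealSubfield F) F (IsCMField.complexConj F) 2 Jstar)) ((t₁ : ↥(finAdelic ↥(maximalRealSubfield F) F (IsCMField.complexConj F) 2 Jstar)) : ↥(finAdelic ↥(maximalRealSubfield F) F (IsCMField.complexConj F) 2 Jstar) ⧸ (K.1.1 : Subgroup ↥(finAdelic ↥(maximalRealSubfield F) F (IsCMField.complexConj F) 2 Jstar)))) → ↥(finAdelic ↥(maximalRealSubfield F) F (IsCMField.complexConj F) 2 Jstar))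
    (hrN₁ : ∀ α, C5.HeckeLE (r₁ α) N K)
    (r₂ : ↥(orbit (K.1.1 : Subgroup ↥(finAdelic ↥(maximalRealSubfield F) F (IsCMField.complexConj F) 2 Jstar)) ((t₂ : ↥(finAdelic ↥(maximalRealSubfield F) F (IsCMField.complexConj F) 2 Jstar)) : ↥(finAdelic ↥(maximalRealSubfield F) F (IsCMField.complexConj F) 2 Jstar) ⧸ (K.1.1 : Subgroup ↥(finAdelic ↥(maximalRealSubfield F) F (IsCMField.complexConj F) 2 Jstar)))) → ↥(finAdelic ↥(maximalRealSubfield F) F (IsCMField.complexConj F) 2 Jstar))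
    (hrN₂ : ∀ α, C5.HeckeLE (r₂ α) N K)
    (x : AlgPoints (S.M.obj N) (AlgebraicClosure (w.adicCompletion F)))
    (N' : C5.SmallLevel K₀) (hN'N : N' ≤ N) (hN'Kc : N' ≤ Kc)
    (x' : AlgPoints (S.M.obj N') (AlgebraicClosure (w.adicCompletion F)))
    (hx' : AlgPoints.map (S.M.map (homOfLE hN'N)) x' = x)
    (rc₁ : ↥(orbit (Kc.1.1 : Subgroup ↥(finAdelic ↥(maximalRealSubfield F) F (IsCMField.complexConj F) 2 Jstar)) ((t₁ : ↥(finAdelic ↥(maximalRealSubfield F) F (IsCMField.complexConj F) 2 Jstar)) : ↥(finAdelic ↥(maximalRealSubfield F) F (IsCMField.complexConj F) 2 Jstar) ⧸ (Kc.1.1 : Subgroup ↥(finAdelic ↥(maximalRealSubfield F) F (IsCMField.complexConj F) 2 Jstar)))) → ↥(finAdelic ↥(maximalRealSubfield F) F (IsCMField.complexConj F) 2 Jstar))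
    (hrcN₁ : ∀ β, C5.HeckeLE (rc₁ β) N' Kc)
    (rc₂ : ↥(orbit (Kc.1.1 : Subgroup ↥(finAdelic ↥(maximalRealSubfield F) F (IsCMField.complexConj F) 2 Jstar)) ((t₂ : ↥(finAdelic ↥(maximalRealSubfield F) F (IsCMField.complexConj F) 2 Jstar)) : ↥(finAdelic ↥(maximalRealSubfield F) F (IsCMField.complexConj F) 2 Jstar) ⧸ (Kc.1.1 : Subgroup ↥(finAdelic ↥(maximalRealSubfield F) F (IsCMField.complexConj F) 2 Jstar)))) → ↥(finAdelic ↥(maximalRealSubfield F) F (IsCMField.complexConj F) 2 Jstar))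
    (hrc₂ : ∀ β, ((rc₂ β : ↥(finAdelic ↥(maximalRealSubfield F) F (IsCMField.complexConj F) 2 Jstar)) : ↥(finAdelic ↥(maximalRealSubfield F) F (IsCMField.complexConj F) 2 Jstar) ⧸
             (Kc.1.1 : Subgroup ↥(finAdelic ↥(maximalRealSubfield F) F (IsCMField.complexConj F) 2 Jstar))) = β.1)
    (hrcN₂ : ∀ β, C5.HeckeLE (rc₂ β) N' Kc)
    (e₁ : ↥(orbit (K.1.1 : Subgroup ↥(finAdelic ↥(maximalRealSubfield F) F (IsCMField.complexConj F) 2 Jstar)) ((t₁ : ↥(finAdelic ↥(maximalRealSubfield F) F (IsCMField.complexConj F) 2 Jstar)) : ↥(finAdelic ↥(maximalRealSubfield F) F (IsCMField.complexConj F) 2 Jstar) ⧸ (K.1.1 : Subgroup ↥(finAdelic ↥(maximalRealSubfield F) F (IsCMField.complexConj F) 2 Jstar)))) ≃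
      ↥(orbit (Kc.1.1 : Subgroup ↥(finAdelic ↥(maximalRealSubfield F) F (IsCMField.complexConj F) 2 Jstar)) ((t₁ : ↥(finAdelic ↥(maximalRealSubfield F) F (IsCMField.complexConj F) 2 Jstar)) : ↥(finAdelic ↥(maximalRealSubfield F) F (IsCMField.complexConj F) 2 Jstar) ⧸ (Kc.1.1 : Subgroup ↥(finAdelic ↥(maximalRealSubfield F) F (IsCMField.complexConj F) 2 Jstar)))))
    (e₂ : ↥(orbit (K.1.1 : Subgroup ↥(finAdelic ↥(maximalRealSubfield F) F (IsCMField.complexConj F) 2 Jstar)) ((t₂ : ↥(finAdelic ↥(maximalRealSubfield F) F (IsCMField.complexConj F) 2 Jstar)) : ↥(finAdelic ↥(maximalRealSubfield F) F (IsCMField.complexConj F) 2 Jstar) ⧸ (K.1.1 : Subgroup ↥(finAdelic ↥(maximalRealSubfield F) F (IsCMField.complexConj F) 2 Jstar)))) ≃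
      ↥(orbit (Kc.1.1 : Subgroup ↥(finAdelic ↥(maximalRealSubfield F) F (IsCMField.complexConj F) 2 Jstar)) ((t₂ : ↥(finAdelic ↥(maximalRealSubfield F) F (IsCMField.complexConj F) 2 Jstar)) : ↥(finAdelic ↥(maximalRealSubfield F) F (IsCMField.complexConj F) 2 Jstar) ⧸ (Kc.1.1 : Subgroup ↥(finAdelic ↥(maximalRealSubfield F) F (IsCMField.complexConj F) 2 Jstar)))))
    (hT₁ : ∀ α, AlgPoints.map (Literature.NumberTheory.Automorphic.Liu2021.AppendixC.recordHeckeTranslateGS S hU7ₛ (r₁ α) N K (hrN₁ α)) x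
        = AlgPoints.map (S.M.map (homOfLE hKcK)) (AlgPoints.map (Literature.NumberTheory.Automorphic.Liu2021.AppendixC.recordHeckeTranslateGS S hU7ₛ (rc₁ (e₁ α)) N' Kc (hrcN₁ (e₁ α))) x'))
    (hT₂ : ∀ α, AlgPoints.map (Literature.NumberTheory.Automorphic.Liu2021.AppendixC.recordHeckeTranslateGS S hU7ₛ (r₂ α) N K (hrN₂ α)) x
        = AlgPoints.map (S.M.map (homOfLE hKcK)) (AlgPoints.map (Literature.NumberTheory.Automorphic.Liu2021.AppendixC.recordHeckeTranslateGS S hU7ₛ (rc₂ (e₂ α)) N' Kc (hrcN₂ (e₂ α))) x'))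
    -- Γ3-Q at `(Kc, K₁, N′, rc₁, x′)`
    (lift : ↥(orbit (Kc.1.1 : Subgroup ↥(finAdelic ↥(maximalRealSubfield F) F (IsCMField.complexConj F) 2 Jstar)) ((t₁ : ↥(finAdelic ↥(maximalRealSubfield F) F (IsCMField.complexConj F) 2 Jstar)) : ↥(finAdelic ↥(maximalRealSubfield F) F (IsCMField.complexConj F) 2 Jstar) ⧸ (Kc.1.1 : Subgroup ↥(finAdelic ↥(maximalRealSubfield F) F (IsCMField.complexConj F) 2 Jstar)))) →
      {y : AlgPoints (S.M.obj K₁) (AlgebraicClosure (w.adicCompletion F)) //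
          AlgPoints.map (S.M.map (homOfLE hle)) y = (AlgPoints.map (S.M.map (homOfLE hN'Kc)) x')})
    (hsurj : Function.Surjective lift)
    (hliftT : ∀ β, AlgPoints.map (Literature.NumberTheory.Automorphic.Liu2021.AppendixC.recordHeckeTranslateGS S hU7ₛ _ K₁ Kc ht) (lift β).1
             = AlgPoints.map (Literature.NumberTheory.Automorphic.Liu2021.AppendixC.recordHeckeTranslateGS S hU7ₛ (rc₁ β) N' Kc (hrcN₁ β)) x')
    -- DEG (a) (b) at `Kc`, and MOD (7) at `u x′`
    (hdeg₁ : Nat.card ↥(orbit (Kc.1.1 : Subgroup ↥(finAdelic ↥(maximalRealSubfield F) F (IsCMField.complexConj F) 2 Jstar)) ((t₁ : ↥(finAdelic ↥(maximalRealSubfield F) F (IsCMField.complexConj F) 2 Jstar)) : ↥(finAdelic ↥(maximalRealSubfield F) F (IsCMField.complexConj F) 2 Jstar) ⧸ (Kc.1.1 : Subgroup ↥(finAdelic ↥(maximalRealSubfield F) F (IsCMField.complexConj F) 2 Jstar)))) = Ideal.absNorm w.asIdeal + 1)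
    (hdeg₂ : ∀ β : ↥(orbit (Kc.1.1 : Subgroup ↥(finAdelic ↥(maximalRealSubfield F) F (IsCMField.complexConj F) 2 Jstar)) ((t₂ : ↥(finAdelic ↥(maximalRealSubfield F) F (IsCMField.complexConj F) 2 Jstar)) : ↥(finAdelic ↥(maximalRealSubfield F) F (IsCMField.complexConj F) 2 Jstar) ⧸ (Kc.1.1 : Subgroup ↥(finAdelic ↥(maximalRealSubfield F) F (IsCMField.complexConj F) 2 Jstar)))),
       (β : ↥(finAdelic ↥(maximalRealSubfield F) F (IsCMField.complexConj F) 2 Jstar) ⧸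
             (Kc.1.1 : Subgroup ↥(finAdelic ↥(maximalRealSubfield F) F (IsCMField.complexConj F) 2 Jstar))) = ((t₂ : ↥(finAdelic ↥(maximalRealSubfield F) F (IsCMField.complexConj F) 2 Jstar)) : ↥(finAdelic ↥(maximalRealSubfield F) F (IsCMField.complexConj F) 2 Jstar) ⧸
             (Kc.1.1 : Subgroup ↥(finAdelic ↥(maximalRealSubfield F) F (IsCMField.complexConj F) 2 Jstar))))
    (h7 : Nat.card {y : AlgPoints (S.M.obj K₁) (AlgebraicClosure (w.adicCompletion F)) //
          AlgPoints.map (S.M.map (homOfLE hle)) y = (AlgPoints.map (S.M.map (homOfLE hN'Kc)) x')} = Ideal.absNorm w.asIdeal + 1) :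
    ∑ᶠ α, ({AlgPoints.map (frobeniusOver 𝒮.reductionAt)
               (𝒮.geomReductionMap (AlgPoints.map (Literature.NumberTheory.Automorphic.Liu2021.AppendixC.recordHeckeTranslateGS S hU7ₛ (r₁ α) N K (hrN₁ α)) x))} :
             Multiset (AlgPoints 𝒮.reductionAt (geomResidueField w)))
      = {AlgPoints.map (frobeniusOver 𝒮.reductionAt) (AlgPoints.map (frobeniusOver 𝒮.reductionAt)
            (𝒮.geomReductionMap (AlgPoints.map (S.M.map (homOfLE hNK)) x)))}
        + ∑ᶠ α, Ideal.absNorm w.asIdeal •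
            ({𝒮.geomReductionMap (AlgPoints.map (Literature.NumberTheory.Automorphic.Liu2021.AppendixC.recordHeckeTranslateGS S hU7ₛ (r₂ α) N K (hrN₂ α)) x)} :
              Multiset (AlgPoints 𝒮.reductionAt (geomResidueField w))) := by
  haveI := Nat.finite_of_card_ne_zero (ne_of_eq_of_ne hdeg₁ (Nat.succ_ne_zero _))
  haveI : Finite ↥(orbit (Kc.1.1 : Subgroup ↥(finAdelic ↥(maximalRealSubfield F) F (IsCMField.complexConj F) 2 Jstar)) ((t₂ : ↥(finAdelic ↥(maximalRealSubfield F) F (IsCMField.complexConj F) 2 Jstar)) : ↥(finAdelic ↥(maximalRealSubfield F) F (IsCMField.complexConj F) 2 Jstar) ⧸ (Kc.1.1 : Subgroup ↥(finAdelic ↥(maximalRealSubfield F) F (IsCMField.complexConj F) 2 Jstar)))) := by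
    haveI : Subsingleton ↥(orbit (Kc.1.1 : Subgroup ↥(finAdelic ↥(maximalRealSubfield F) F (IsCMField.complexConj F) 2 Jstar)) ((t₂ : ↥(finAdelic ↥(maximalRealSubfield F) F (IsCMField.complexConj F) 2 Jstar)) : ↥(finAdelic ↥(maximalRealSubfield F) F (IsCMField.complexConj F) 2 Jstar) ⧸ (Kc.1.1 : Subgroup ↥(finAdelic ↥(maximalRealSubfield F) F (IsCMField.complexConj F) 2 Jstar)))) :=
      ⟨fun a b => Subtype.ext ((hdeg₂ a).trans (hdeg₂ b).symm)⟩
    infer_instance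
  have hinj : Function.Injective lift := (hsurj.bijective_of_nat_card_le (hdeg₁.trans h7.symm).le).1
  -- C3 at `(Kc, 𝒮c, N′, rc₁, rc₂, x′)` by the CORE (§2)
  have core := finsum_translate_eq_of_two_sections F ι₁ Jstar K₀ S hU7ₛ Kc w 𝒮c t₁ t₂ K₁ hle ht ht₂ 𝒯 π₁ π₂ hπ₁ hπ₂ s s' V hcov hs hV
    hs₂ hs'₂ N' hN'Kc rc₁ hrcN₁ x' lift hsurj hinj hliftT hdeg₁ rc₂ hrc₂ hrcN₂ hdeg₂
  -- push forward along `ū_v` and reindex along `e₁ e₂` (★ p808737 `IntegralModel.finsum_congruence_pushforward_reindex`)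
  have push := Literature.AlgebraicGeometry.Motives.IntegralModel.finsum_congruence_pushforward_reindex 𝒮c 𝒮 ū
    (S.M.map (homOfLE hKcK)) hū e₁ e₂
    (fun β => AlgPoints.map (Literature.NumberTheory.Automorphic.Liu2021.AppendixC.recordHeckeTranslateGS S hU7ₛ (rc₁ β) N' Kc (hrcN₁ β)) x') (AlgPoints.map (S.M.map (homOfLE hN'Kc)) x')
    (fun β => AlgPoints.map (Literature.NumberTheory.Automorphic.Liu2021.AppendixC.recordHeckeTranslateGS S hU7ₛ (rc₂ β) N' Kc (hrcN₂ β)) x') (Ideal.absNorm w.asIdeal) core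
  -- `u_{N→K} x = u_{Kc→K} (u_{N′→Kc} x′)`
  have hux : (AlgPoints.map (S.M.map (homOfLE hNK)) x) = AlgPoints.map (S.M.map (homOfLE hKcK)) (AlgPoints.map (S.M.map (homOfLE hN'Kc)) x') := by
    rw [← hx', ← AlgPoints.map_comp_apply, ← AlgPoints.map_comp_apply, ← S.M.map_comp, ← S.M.map_comp]
    rfl
  -- rewrite the DESC identities pointwise (term mode)
  have hL : ∑ᶠ α, ({AlgPoints.map (frobeniusOver 𝒮.reductionAt)
        (𝒮.geomReductionMap (AlgPoints.map (Literature.NumberTheory.Automorphic.Liu2021.AppendixC.recordHeckeTranslateGS S hU7ₛ (r₁ α) N K (hrN₁ α)) x))} : Multiset (AlgPoints 𝒮.reductionAt (geomResidueField w)))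
      = ∑ᶠ α, ({AlgPoints.map (frobeniusOver 𝒮.reductionAt) (𝒮.geomReductionMap
          (AlgPoints.map (S.M.map (homOfLE hKcK)) (AlgPoints.map (Literature.NumberTheory.Automorphic.Liu2021.AppendixC.recordHeckeTranslateGS S hU7ₛ (rc₁ (e₁ α)) N' Kc (hrcN₁ (e₁ α))) x')))} : Multiset (AlgPoints 𝒮.reductionAt (geomResidueField w))) :=
    finsum_congr fun α =>
      congrArg (fun P => ({AlgPoints.map (frobeniusOver 𝒮.reductionAt) (𝒮.geomReductionMap P)} : Multiset (AlgPoints 𝒮.reductionAt (geomResidueField w)))) (hT₁ α)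
  have hA : ({AlgPoints.map (frobeniusOver 𝒮.reductionAt) (AlgPoints.map (frobeniusOver 𝒮.reductionAt)
        (𝒮.geomReductionMap (AlgPoints.map (S.M.map (homOfLE hNK)) x)))} : Multiset (AlgPoints 𝒮.reductionAt (geomResidueField w)))
      = {AlgPoints.map (frobeniusOver 𝒮.reductionAt) (AlgPoints.map (frobeniusOver 𝒮.reductionAt)
        (𝒮.geomReductionMap (AlgPoints.map (S.M.map (homOfLE hKcK)) (AlgPoints.map (S.M.map (homOfLE hN'Kc)) x'))))} :=
    congrArg (fun P => ({AlgPoints.map (frobeniusOver 𝒮.reductionAt) (AlgPoints.map (frobeniusOver 𝒮.reductionAt)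
        (𝒮.geomReductionMap P))} : Multiset (AlgPoints 𝒮.reductionAt (geomResidueField w)))) hux
  have hR : ∑ᶠ α, Ideal.absNorm w.asIdeal •
        ({𝒮.geomReductionMap (AlgPoints.map (Literature.NumberTheory.Automorphic.Liu2021.AppendixC.recordHeckeTranslateGS S hU7ₛ (r₂ α) N K (hrN₂ α)) x)} : Multiset (AlgPoints 𝒮.reductionAt (geomResidueField w)))
      = ∑ᶠ α, Ideal.absNorm w.asIdeal • ({𝒮.geomReductionMap
          (AlgPoints.map (S.M.map (homOfLE hKcK)) (AlgPoints.map (Literature.NumberTheory.Automorphic.Liu2021.AppendixC.recordHeckeTranslateGS S hU7ₛ (rc₂ (e₂ α)) N' Kc (hrcN₂ (e₂ α))) x'))} : Multiset (AlgPoints 𝒮.reductionAt (geomResidueField w))) :=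
    finsum_congr fun α =>
      congrArg (fun P => Ideal.absNorm w.asIdeal • ({𝒮.geomReductionMap P} : Multiset (AlgPoints 𝒮.reductionAt (geomResidueField w)))) (hT₂ α)
  exact hL.trans (push.trans (congrArg₂ HAdd.hAdd hA hR).symm)

/-! ### §4 The PEN `stub_C3_of` (∃-plumbing over §2b: stage B here, stage A = the `stub_C3_of` body below; default heartbeats; NB no `fun … => ?_` holes inside `refine` —
such a delayed-assigned hole under binders over this goal alone costs > 200 k heartbeats; `recordHeckeTranslateGS` fully qualified per (F1)) -/

/-- **PEN, stage B** — C3 at `(K, 𝒮, N, r₁, r₂, x)` from the MOD datum ALREADY CHOSEN at `w` (`𝒮, Kc, 𝒮c, ū` and the inner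
`∀ K₁ …` package `hMOD₁` of `RecordCurveCongruenceCorrespondenceCofinal`, verbatim) and the four letters Γ3-Q, DEG, DESC, FULL: unpack DESC at
`(N, r₁, r₂, x)`, DEG at `Kc`, build `K₁ = Kc ∩ t₁ Kc t₁⁻¹` (§1e), unpack MOD at `(K₁, hle, ht, hK₁, ht₂)` and Γ3-Q at `(Kc, K₁, N′, rc₁, x′)`,
full fibres from FULL ∘ ★ (b10) ∘ DEG (a), then §2b. [cite: Liu2021, Prop. D.8 (1)–(3) and proof of Cor. D.9 p. 139 L4–L31] -/
theorem congruenceOnPoints_at_of_letters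
    (hQ : HeckeSumReindexing) (hDEG : HeckeDegreeSplitPlace) (hDESC : HeckeMultisetLevelDescent) (hFULL : RecordNeatLevelFullFibres)
    (F : Type) [Field F] [NumberField F] [IsCMField F] [IsGalois ℚ F] (ι₁ : F →+* ℂ)
    (Jstar : Matrix (Fin 2) (Fin 2) F)
    (K₀ : C5.OpenCompactSubgroup ↥(finAdelic ↥(maximalRealSubfield F) F (IsCMField.complexConj F) 2 Jstar))
    (S : RecordSystemGS F Jstar ι₁ K₀) (hU7ₛ : S.HeckeTranslateDefinedOver)
    (hJ : (Jstar.map (IsCMField.complexConj F))ᵀ = Jstar) (hJu : IsUnit Jstar) (K : C5.SmallLevel K₀)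
    (w : HeightOneSpectrum (𝓞 F)) (hw : (IsCMField.complexConj F) • w ≠ w)
    (hJi : (UnitaryGroup.isUnit_placeForm Jstar hJu w).unit ∈ glInt 2 (w.adicCompletion F))
    (hK : UnitaryGroup.IsHyperspecialAt ↥(maximalRealSubfield F) F (IsCMField.complexConj F) 2 Jstar K.1.1
      (w.under (𝓞 ↥(maximalRealSubfield F))))
    (𝒮 : IntegralModel (HeightOneSpectrum.valuationSubringAtPrime F w) F (S.M.obj K))
    [IsProper 𝒮.total.hom]
    (Kc : C5.SmallLevel K₀) (hKcK : Kc ≤ K)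
    (hKc : UnitaryGroup.IsHyperspecialAt ↥(maximalRealSubfield F) F (IsCMField.complexConj F) 2 Jstar Kc.1.1
      (w.under (𝓞 ↥(maximalRealSubfield F))))
    (𝒮c : IntegralModel (HeightOneSpectrum.valuationSubringAtPrime F w) F (S.M.obj Kc)) [IsProper 𝒮c.total.hom]
    (ū : 𝒮c.total ⟶ 𝒮.total)
    (hū : (genericFibre (HeightOneSpectrum.valuationSubringAtPrime F w) F).map ū ≫ 𝒮.genericIso'.hom
       = 𝒮c.genericIso'.hom ≫ S.M.map (homOfLE hKcK))
    (hMOD₁ :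
           ∀ (K₁ : C5.SmallLevel K₀) (hle : K₁ ≤ Kc)
             (ht : C5.HeckeLE
                (UnitaryGroup.heckeElementAt ↥(maximalRealSubfield F) F (IsCMField.complexConj F) 2 Jstar
                    (⟨w, rfl⟩ : UnitaryGroup.PlacesOver F (w.under (𝓞 ↥(maximalRealSubfield F))))
                    (IsCMField.complexConj_ne_one F) hJ hw (UnitaryGroup.isUnit_placeForm Jstar hJu w) (HeckeCharacter.uniformizer F w) 1 :
                  ↥(finAdelic ↥(maximalRealSubfield F) F (IsCMField.complexConj F) 2 Jstar)) K₁ Kc)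
             (_hK₁ : (K₁.1.1 : Subgroup ↥(finAdelic ↥(maximalRealSubfield F) F (IsCMField.complexConj F) 2 Jstar))
                = Kc.1.1 ⊓ (Kc.1.1).map (MulAut.conj
                    (UnitaryGroup.heckeElementAt ↥(maximalRealSubfield F) F (IsCMField.complexConj F) 2 Jstar
                      (⟨w, rfl⟩ : UnitaryGroup.PlacesOver F (w.under (𝓞 ↥(maximalRealSubfield F))))
                      (IsCMField.complexConj_ne_one F) hJ hw (UnitaryGroup.isUnit_placeForm Jstar hJu w) (HeckeCharacter.uniformizer F w) 1 :
                    ↥(finAdelic ↥(maximalRealSubfield F) F (IsCMField.complexConj F) 2 Jstar))).toMonoidHom)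
             (ht₂ : C5.HeckeLE
                (UnitaryGroup.heckeElementAt ↥(maximalRealSubfield F) F (IsCMField.complexConj F) 2 Jstar
                    (⟨w, rfl⟩ : UnitaryGroup.PlacesOver F (w.under (𝓞 ↥(maximalRealSubfield F))))
                    (IsCMField.complexConj_ne_one F) hJ hw (UnitaryGroup.isUnit_placeForm Jstar hJu w) (HeckeCharacter.uniformizer F w) 2 :
                  ↥(finAdelic ↥(maximalRealSubfield F) F (IsCMField.complexConj F) 2 Jstar)) Kc Kc),
           ∃ (𝒯 : IntegralModel (HeightOneSpectrum.valuationSubringAtPrime F w) F (S.M.obj K₁))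
             (_h𝒯 : AlgebraicGeometry.IsProper 𝒯.total.hom)
             (π₁ π₂ : 𝒯.total ⟶ 𝒮c.total)
             (_hflat : AlgebraicGeometry.Flat π₁.left) (_hlfp : AlgebraicGeometry.LocallyOfFinitePresentation π₁.left)
             (_hfin : AlgebraicGeometry.IsFinite π₁.left)
             (_hπ₁ : (genericFibre (HeightOneSpectrum.valuationSubringAtPrime F w) F).map π₁ ≫ 𝒮c.genericIso'.hom
                = 𝒯.genericIso'.hom ≫ S.M.map (homOfLE hle))
             (_hπ₂ : (genericFibre (HeightOneSpectrum.valuationSubringAtPrime F w) F).map π₂ ≫ 𝒮c.genericIso'.hom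
                = 𝒯.genericIso'.hom ≫ Literature.NumberTheory.Automorphic.Liu2021.AppendixC.recordHeckeTranslateGS S hU7ₛ _ K₁ Kc ht)
             (s s' : AlgPoints 𝒮c.reductionAt (geomResidueField w) → AlgPoints 𝒯.reductionAt (geomResidueField w))
             (V : (𝒯.reductionAt).left.Opens)
             (_hV : AlgebraicGeometry.IsOpenImmersion (V.ι ≫ ((specialFibreFunctor w).map π₁).left)),
             haveI : AlgebraicGeometry.IsProper 𝒯.total.hom := _h𝒯
             (∀ (z : AlgPoints 𝒯.reductionAt (geomResidueField w)) (yb : AlgPoints 𝒮c.reductionAt (geomResidueField w)),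
                 AlgPoints.map ((specialFibreFunctor w).map π₁) z = yb → z = s yb ∨ z = s' yb) ∧
             (∀ yb : AlgPoints 𝒮c.reductionAt (geomResidueField w), AlgPoints.map ((specialFibreFunctor w).map π₁) (s yb) = yb) ∧
             (∀ yb : AlgPoints 𝒮c.reductionAt (geomResidueField w), AlgPoints.map ((specialFibreFunctor w).map π₁) (s' yb) = yb) ∧
             (∀ yb : AlgPoints 𝒮c.reductionAt (geomResidueField w),
                 s yb ≠ s' yb → (s yb).toSpecHom.base (closedPoint (geomResidueField w)) ∈ V) ∧
             (∀ yb : AlgPoints 𝒮c.reductionAt (geomResidueField w),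
                 AlgPoints.map ((specialFibreFunctor w).map π₂) (s yb) = AlgPoints.map (frobeniusOver 𝒮c.reductionAt) yb) ∧
             (∀ y : AlgPoints (S.M.obj Kc) (AlgebraicClosure (w.adicCompletion F)),
                 AlgPoints.map (frobeniusOver 𝒮c.reductionAt)
                     (AlgPoints.map ((specialFibreFunctor w).map π₂) (s' (𝒮c.geomReductionMap y)))
                   = 𝒮c.geomReductionMap (AlgPoints.map (Literature.NumberTheory.Automorphic.Liu2021.AppendixC.recordHeckeTranslateGS S hU7ₛ _ Kc Kc ht₂) y)))
    (N : C5.SmallLevel K₀) (hNK : N ≤ K)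
    (r₁ : ↥(orbit (K.1.1 : Subgroup ↥(finAdelic ↥(maximalRealSubfield F) F (IsCMField.complexConj F) 2 Jstar)) (((UnitaryGroup.heckeElementAt ↥(maximalRealSubfield F) F (IsCMField.complexConj F) 2 Jstar
             (⟨w, rfl⟩ : UnitaryGroup.PlacesOver F (w.under (𝓞 ↥(maximalRealSubfield F))))
             (IsCMField.complexConj_ne_one F) hJ hw (UnitaryGroup.isUnit_placeForm Jstar hJu w) (HeckeCharacter.uniformizer F w) 1 :
           ↥(finAdelic ↥(maximalRealSubfield F) F (IsCMField.complexConj F) 2 Jstar)) : ↥(finAdelic ↥(maximalRealSubfield F) F (IsCMField.complexConj F) 2 Jstar)) : ↥(finAdelic ↥(maximalRealSubfield F) F (IsCMField.complexConj F) 2 Jstar) ⧸ (K.1.1 : Subgroup ↥(finAdelic ↥(maximalRealSubfield F) F (IsCMField.complexConj F) 2 Jstar)))) → ↥(finAdelic ↥(maximalRealSubfield F) F (IsCMField.complexConj F) 2 Jstar))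
    (hr₁ : ∀ α, ((r₁ α : ↥(finAdelic ↥(maximalRealSubfield F) F (IsCMField.complexConj F) 2 Jstar)) : ↥(finAdelic ↥(maximalRealSubfield F) F (IsCMField.complexConj F) 2 Jstar) ⧸
             (K.1.1 : Subgroup ↥(finAdelic ↥(maximalRealSubfield F) F (IsCMField.complexConj F) 2 Jstar))) = α.1)
    (hrN₁ : ∀ α, C5.HeckeLE (r₁ α) N K)
    (r₂ : ↥(orbit (K.1.1 : Subgroup ↥(finAdelic ↥(maximalRealSubfield F) F (IsCMField.complexConj F) 2 Jstar)) (((UnitaryGroup.heckeElementAt ↥(maximalRealSubfield F) F (IsCMField.complexConj F) 2 Jstar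
             (⟨w, rfl⟩ : UnitaryGroup.PlacesOver F (w.under (𝓞 ↥(maximalRealSubfield F))))
             (IsCMField.complexConj_ne_one F) hJ hw (UnitaryGroup.isUnit_placeForm Jstar hJu w) (HeckeCharacter.uniformizer F w) 2 :
           ↥(finAdelic ↥(maximalRealSubfield F) F (IsCMField.complexConj F) 2 Jstar)) : ↥(finAdelic ↥(maximalRealSubfield F) F (IsCMField.complexConj F) 2 Jstar)) : ↥(finAdelic ↥(maximalRealSubfield F) F (IsCMField.complexConj F) 2 Jstar) ⧸ (K.1.1 : Subgroup ↥(finAdelic ↥(maximalRealSubfield F) F (IsCMField.complexConj F) 2 Jstar)))) → ↥(finAdelic ↥(maximalRealSubfield F) F (IsCMField.complexConj F) 2 Jstar))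
    (hr₂ : ∀ α, ((r₂ α : ↥(finAdelic ↥(maximalRealSubfield F) F (IsCMField.complexConj F) 2 Jstar)) : ↥(finAdelic ↥(maximalRealSubfield F) F (IsCMField.complexConj F) 2 Jstar) ⧸
             (K.1.1 : Subgroup ↥(finAdelic ↥(maximalRealSubfield F) F (IsCMField.complexConj F) 2 Jstar))) = α.1)
    (hrN₂ : ∀ α, C5.HeckeLE (r₂ α) N K)
    (x : AlgPoints (S.M.obj N) (AlgebraicClosure (w.adicCompletion F))) :
    ∑ᶠ α, ({AlgPoints.map (frobeniusOver 𝒮.reductionAt)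
               (𝒮.geomReductionMap (AlgPoints.map (Literature.NumberTheory.Automorphic.Liu2021.AppendixC.recordHeckeTranslateGS S hU7ₛ (r₁ α) N K (hrN₁ α)) x))} :
             Multiset (AlgPoints 𝒮.reductionAt (geomResidueField w)))
      = {AlgPoints.map (frobeniusOver 𝒮.reductionAt) (AlgPoints.map (frobeniusOver 𝒮.reductionAt)
            (𝒮.geomReductionMap (AlgPoints.map (S.M.map (homOfLE hNK)) x)))}
        + ∑ᶠ α, Ideal.absNorm w.asIdeal •
            ({𝒮.geomReductionMap (AlgPoints.map (Literature.NumberTheory.Automorphic.Liu2021.AppendixC.recordHeckeTranslateGS S hU7ₛ (r₂ α) N K (hrN₂ α)) x)} :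
              Multiset (AlgPoints 𝒮.reductionAt (geomResidueField w))) := by
  have hDESCx := hDESC F ι₁ Jstar K₀ S hU7ₛ hJ hJu K w hw hJi hK Kc hKcK hKc N hNK r₁ hr₁ hrN₁ r₂ hr₂ hrN₂ x
  obtain ⟨N', hN'N, hN'Kc, x', hx', rc₁, hrc₁, hrcN₁, rc₂, hrc₂, hrcN₂, e₁, e₂, hT₁, hT₂⟩ := hDESCx
  have hDEGx := hDEG F Jstar hJ hJu Kc.1.1 w hw hJi hKc
  obtain ⟨hdeg₁, hdeg₂, hnorm⟩ := hDEGx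
  have hK₁x := C5.SmallLevel.exists_le_le_heckeLevel_val_eq Kc
    (UnitaryGroup.heckeElementAt ↥(maximalRealSubfield F) F (IsCMField.complexConj F) 2 Jstar
             (⟨w, rfl⟩ : UnitaryGroup.PlacesOver F (w.under (𝓞 ↥(maximalRealSubfield F))))
             (IsCMField.complexConj_ne_one F) hJ hw (UnitaryGroup.isUnit_placeForm Jstar hJu w) (HeckeCharacter.uniformizer F w) 1 :
           ↥(finAdelic ↥(maximalRealSubfield F) F (IsCMField.complexConj F) 2 Jstar))
  obtain ⟨K₁, hle, _, ht, hK₁⟩ := hK₁x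
  have hMODy := hMOD₁ K₁ hle ht hK₁ hnorm
  obtain ⟨𝒯, h𝒯, π₁, π₂, hflat, hlfp, hfin, hπ₁, hπ₂, s, s', V, hV, hcov, hs, _hs', hVs, hs₂, hs'₂⟩ := hMODy
  -- full fibres (ED. 5.2): FULL at `(Kc, K₁)` (hypothesis-free), `[Kc : K₁] = #orbit_Kc(t₁ Kc)` (★ (b10)), DEG (a) at `Kc`
  have h7 : Nat.card {y : AlgPoints (S.M.obj K₁) (AlgebraicClosure (w.adicCompletion F)) //
          AlgPoints.map (S.M.map (homOfLE hle)) y = (AlgPoints.map (S.M.map (homOfLE hN'Kc)) x')} = Ideal.absNorm w.asIdeal + 1 :=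
    (hFULL F ι₁ Jstar K₀ S hJ hJu Kc K₁ hle w (AlgPoints.map (S.M.map (homOfLE hN'Kc)) x')).trans (by
      rw [hK₁, Literature.GroupTheory.Index.relIndex_inf_map_conj_eq_natCard_orbit]
      exact hdeg₁)
  haveI : IsProper 𝒯.total.hom := h𝒯
  haveI : Flat π₁.left := hflat
  haveI : LocallyOfFinitePresentation π₁.left := hlfp
  haveI : IsFinite π₁.left := hfin
  haveI : IsOpenImmersion (V.ι ≫ ((specialFibreFunctor w).map π₁).left) := hV
  have hQx := hQ F ι₁ Jstar K₀ S hU7ₛ hJ hJu Kc w hw K₁ hle ht hK₁ N' hN'Kc rc₁ hrc₁ hrcN₁ x'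
  obtain ⟨lift, hsurj, hliftT⟩ := hQx
  exact congruenceOnPoints_at_of_descent F ι₁ Jstar K₀ S hU7ₛ K w 𝒮 _ _ Kc hKcK 𝒮c ū hū K₁ hle ht hnorm 𝒯 π₁ π₂ hπ₁ hπ₂ s s' V
    hcov hs hVs hs₂ hs'₂ N hNK r₁ hrN₁ r₂ hrN₂ x N' hN'N hN'Kc x' hx' rc₁ hrcN₁ rc₂ hrc₂ hrcN₂ e₁ e₂ hT₁ hT₂ lift hsurj hliftT
    hdeg₁ hdeg₂ h7

end PenLemmas
end Edition5Desk
end Summit.HodgeConjecture.HodgeConjecture.Cruxes.HLiu418.F0D9opRoad2
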